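import Mathlib
import HarnessLib
import Summits.HubbardSuperconductivity.HubbardSuperconductivity.Theorems.KLProgrammeKLRegimeTwoVolumeSrcBlockIdentity
import Summits.HubbardSuperconductivity.HubbardSuperconductivity.Theorems.KLProgrammeKLRegimeTwoVolumeSrcSpeciesStep
import Summits.HubbardSuperconductivity.HubbardSuperconductivity.Theorems.KLProgrammeKLRegimeTwoVolumeTowerTruncProfileBridge
import Summits.HubbardSuperconductivity.HubbardSuperconductivity.Theorems.KLProgrammeKLRegimeEngineTowerBlockIncrWt

/-!
# Route `KLProgramme` — crux K3, VL child `KLRegimeVolumeLimitV17F3` (stmt-HubbardSuperconductivity-23356), producer route «(VL)-SRC-SOFT» §S3: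
# THE SOURCE-SPECIES BLOCK STEP OF THE MODEL, door level — `klSrcPinnedSumAt` across a block of scales `(k+1 → J₂)`, read at `F_{J′}`,
# from the species profiles at the block boundary, with the block constants `(κ, α, cr, cc)` as hypotheses
# (seat hubbard-kl-k3c4-p1 g19; `--supports` 23356)

Model instance of the generic source-species block step `…TwoVolumeSrcSpeciesStep.sum_species_wt_norm_kernel_blockStep_le` (S2, p669032) along the identity
`…TwoVolumeSrcBlockIdentity.klSrcBlock_eq_map_doubleBlock_effAction` (S1, p668045): labels `SrcLabel L M k → SrcLabel L M J′`, tree weight `klScaleWt … r`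
(`isTreeWeight_klScaleWt`) on the positions `latticeLegPos (2·(2M))` of both copies, block covariance `S(F̃_k)ᵀ C^K_{(Λ_{J₂},Λ_{k+1}]} S(F̃_k)` with its spectator lift,
input `D_{k+1} = klTowerD … k` (even, no constant part when `Z^K_{Λ_{k+1}} ≠ 0`; its species profiles ARE `ε · klSrcPinnedSumAt … k r (k+1) s`,
`…TowerTruncProfileBridge.sum_srcCount_filter_eq_eps_mul_klSrcPinnedSumAt`), substitution `T⁺ = (ε•E(F_{J′})·S(F̃_k)) ⊕ J` (alive weighted costs `ε·cr`, `ε·cc`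
from the engine's overlap rows; the slot-`0` identity `J` costs `1`: one partner at the same site, `klScaleWt` of a singleton is `1`), output
`map (toLin' (ε•klSrcAnalysisAt … J′)) 𝒱_{J₂}` whose species profiles ARE `ε · klSrcPinnedSumAt … J′ r J₂ s` (`kernel_map_smul_klSrcAnalysisAt`).

* `sum_norm_slotShift_mul_row_le_one`, `sum_norm_slotShift_mul_col_le_one` — the weighted costs of the slot-`0` identity block are `≤ 1`;
* `sum_norm_srcDoubleBlock_mul_row_le`, `…_col_le` — the weighted costs of `T⁺` are `≤ max (ε·cr) 1`, `≤ max (ε·cc) 1`;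
* **`klSrcPinnedSumAt_blockStep_le`** — for `k + 1 ≤ J₂`, `k + 1 ≤ J′`, `Z^K_{Λ_{k+1}} ≠ 0`, block constants `(κ, α, cr, cc)`, species budgets
  `klSrcPinnedSumAt … k r (k+1) s m q w ≤ S s m` (`s ≤ 2`), `0 < t`, radius `ρ` with the doors' guard at the profile `N_t m′ = ε(S 0 (2m′) + t·S 1 (2m′) + t²·S 2 (2m′))`:
  `ε · klSrcPinnedSumAt … J′ r J₂ s (2(q+1)) p w″ ≤ t^{-s} · max (ε cr) 1 · (max (ε cc) 1)^{2q+1} · [N_t (q+1) + binomial_{q+1}(N_t) + graded_{2q+2}(N_t)]`.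
The block constants are discharged from the binder's TowerP in the assembly file (E1's `gram_sliceCT_bgmFat_sharp_klEng`,
`alphaWt_blockSliceCT_bgmFat_klEng_flow_all'`, `overlapWt_jump_sums_klEng_flow_all`), the brackets turned into the law by `…TwoVolumeSrcLawStep` (T2ε).
Compositions of landed theorems; nothing about the model's sizes is asserted beyond them; nothing asserts any stub, VL, K3 or superconductivity.
References: BGM 2006 §2.7 (2.70)–(2.71a), §2.8 (2.80)–(2.83), §2.9 (4.3)–(4.8), §3 (3.2)–(3.8) [cite: BenfattoGiulianiMastropietro2006].
-/

noncomputable section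

namespace Summit.HubbardSuperconductivity.HubbardSuperconductivity.Theorems.TwoVolumeDefect

set_option linter.dupNamespace false -- summit = problem name (single-conjunct summit), D-0017

open Real Finset Literature.MathematicalPhysics.QuantumLattice GrassmannAlgebra Literature.Probability.LatticeModels
open Literature.Probability.LatticeModels.BattleFederbush
open Summit.HubbardSuperconductivity.HubbardSuperconductivity.Theorems.KLProgrammeLegKernels
open Summit.HubbardSuperconductivity.HubbardSuperconductivity.Theorems.KLRegimeSplit
open Summit.HubbardSuperconductivity.HubbardSuperconductivity.Theorems.EngineV8
open Summit.HubbardSuperconductivity.HubbardSuperconductivity.Theorems.TwoVolumeSource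

variable {L M : ℕ} [NeZero L] [NeZero M]

/-! ## §1 The weighted costs of the slot-`0` identity and of the doubled block -/

/-- **The slot-`0` identity has at most one partner per row, at the same site**: its `klScaleWt`-weighted row sums are `≤ 1` (`0 < N`). [folklore] -/
theorem sum_norm_slotShift_mul_row_le_one {β : ℝ} (hβ : 0 ≤ β) (r : ℕ) {N N' : ℕ} (hN : 0 < N)
    (Jm : Matrix (SpaceTimeIdx L M × SectorLeg N') (SpaceTimeIdx L M × SectorLeg N) ℂ)
    (hJm : ∀ Y' Y, Jm Y' Y = if Y'.1 = Y.1 ∧ (Y'.2.1.1 : ℕ) = 0 ∧ (Y.2.1.1 : ℕ) = 0 ∧ Y'.2.1.2 = Y.2.1.2 ∧ Y'.2.2 = Y.2.2 then 1 else 0)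
    (Y' : SpaceTimeIdx L M × SectorLeg N') :
    ∑ Y, ‖Jm Y' Y‖ * klScaleWt L M β r {latticeLegPos (2 * (2 * M)) Y', latticeLegPos (2 * (2 * M)) Y} ≤ 1 := by
  haveI : NeZero (2 * (2 * M)) := ⟨by have := NeZero.ne M; omega⟩
  -- the only candidate partner
  set Y₀ : SpaceTimeIdx L M × SectorLeg N := (Y'.1, ((⟨0, hN⟩, Y'.2.1.2), Y'.2.2)) with hY₀
  have hzero : ∀ Y, Y ≠ Y₀ → Jm Y' Y = 0 := by
    intro Y hY
    rw [hJm, if_neg]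
    rintro ⟨h1, -, h3, h4, h5⟩
    apply hY
    rw [hY₀]
    refine Prod.ext h1.symm (Prod.ext (Prod.ext (Fin.ext ?_) h4.symm) h5.symm)
    simpa using h3
  rw [Finset.sum_eq_single Y₀ (fun Y _ hY => by rw [hzero Y hY, norm_zero, zero_mul]) (fun h => absurd (mem_univ _) h)]
  have hpos : latticeLegPos (2 * (2 * M)) Y₀ = latticeLegPos (2 * (2 * M)) Y' := by rw [hY₀]; rfl
  rw [hpos, Finset.insert_eq_of_mem (Finset.mem_singleton_self _), klScaleWt_apply, labelDiam_singleton (isLabelDist_gridLabelDist L (2 * (2 * M)) hβ), mul_zero, add_zero,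
    mul_one]
  rw [hJm]
  split_ifs <;> simp

/-- **The slot-`0` identity has at most one partner per column, at the same site**: its `klScaleWt`-weighted column sums are `≤ 1` (`0 < N′`). [folklore] -/
theorem sum_norm_slotShift_mul_col_le_one {β : ℝ} (hβ : 0 ≤ β) (r : ℕ) {N N' : ℕ} (hN' : 0 < N')
    (Jm : Matrix (SpaceTimeIdx L M × SectorLeg N') (SpaceTimeIdx L M × SectorLeg N) ℂ)
    (hJm : ∀ Y' Y, Jm Y' Y = if Y'.1 = Y.1 ∧ (Y'.2.1.1 : ℕ) = 0 ∧ (Y.2.1.1 : ℕ) = 0 ∧ Y'.2.1.2 = Y.2.1.2 ∧ Y'.2.2 = Y.2.2 then 1 else 0)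
    (Y : SpaceTimeIdx L M × SectorLeg N) :
    ∑ Y', ‖Jm Y' Y‖ * klScaleWt L M β r {latticeLegPos (2 * (2 * M)) Y', latticeLegPos (2 * (2 * M)) Y} ≤ 1 := by
  haveI : NeZero (2 * (2 * M)) := ⟨by have := NeZero.ne M; omega⟩
  set Y₀ : SpaceTimeIdx L M × SectorLeg N' := (Y.1, ((⟨0, hN'⟩, Y.2.1.2), Y.2.2)) with hY₀
  have hzero : ∀ Y', Y' ≠ Y₀ → Jm Y' Y = 0 := by
    intro Y' hY'
    rw [hJm, if_neg]
    rintro ⟨h1, h2, -, h4, h5⟩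
    apply hY'
    rw [hY₀]
    refine Prod.ext h1 (Prod.ext (Prod.ext (Fin.ext ?_) h4) h5)
    simpa using h2
  rw [Finset.sum_eq_single Y₀ (fun Y' _ hY' => by rw [hzero Y' hY', norm_zero, zero_mul]) (fun h => absurd (mem_univ _) h)]
  have hpos : latticeLegPos (2 * (2 * M)) Y₀ = latticeLegPos (2 * (2 * M)) Y := by rw [hY₀]; rfl
  rw [hpos, Finset.insert_eq_of_mem (Finset.mem_singleton_self _), klScaleWt_apply, labelDiam_singleton (isLabelDist_gridLabelDist L (2 * (2 * M)) hβ), mul_zero, add_zero,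
    mul_one]
  rw [hJm]
  split_ifs <;> simp

omit [NeZero M] in
/-- **Weighted row sums of a doubled block**: alive rows `≤ a`, source rows `≤ b` ⇒ all rows `≤ max a b`. [folklore] -/
theorem sum_norm_srcDoubleBlock_mul_row_le {N N' : ℕ} (T J : Matrix (SpaceTimeIdx L M × SectorLeg N') (SpaceTimeIdx L M × SectorLeg N) ℂ)
    (Tp : Matrix ((SpaceTimeIdx L M × SectorLeg N') × Fin 2) ((SpaceTimeIdx L M × SectorLeg N) × Fin 2) ℂ)
    (hTp : ∀ p' p, Tp p' p = if p'.2 = 0 ∧ p.2 = 0 then T p'.1 p.1 else if p'.2 = 1 ∧ p.2 = 1 then J p'.1 p.1 else 0)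
    (g : (SpaceTimeIdx L M × SectorLeg N') → (SpaceTimeIdx L M × SectorLeg N) → ℝ) {a b : ℝ}
    (hT : ∀ x, ∑ y, ‖T x y‖ * g x y ≤ a) (hJ : ∀ x, ∑ y, ‖J x y‖ * g x y ≤ b) (p' : (SpaceTimeIdx L M × SectorLeg N') × Fin 2) :
    ∑ p, ‖Tp p' p‖ * g p'.1 p.1 ≤ max a b := by
  have h10 : ¬ ((1 : Fin 2) = 0) := by decide
  have h01 : ¬ ((0 : Fin 2) = 1) := by decide
  have e00 : ∀ x y, Tp (x, 0) (y, 0) = T x y := fun x y => by rw [hTp, if_pos ⟨rfl, rfl⟩]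
  have e11 : ∀ x y, Tp (x, 1) (y, 1) = J x y := fun x y => by rw [hTp, if_neg (fun h => h10 h.1), if_pos ⟨rfl, rfl⟩]
  have e01 : ∀ x y, Tp (x, 0) (y, 1) = 0 := fun x y => by rw [hTp, if_neg (fun h => h10 h.2), if_neg (fun h => h01 h.1)]
  have e10 : ∀ x y, Tp (x, 1) (y, 0) = 0 := fun x y => by rw [hTp, if_neg (fun h => h10 h.1), if_neg (fun h => h01 h.2)]
  obtain ⟨x', s⟩ := p'
  rw [Fintype.sum_prod_type]
  simp_rw [Fin.sum_univ_two]
  rcases Fin.exists_fin_two.1 ⟨s, rfl⟩ with hs | hs <;> subst hs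
  · simp only [e00, e01, norm_zero, zero_mul, add_zero]
    exact (hT x').trans (le_max_left _ _)
  · simp only [e10, e11, norm_zero, zero_mul, zero_add]
    exact (hJ x').trans (le_max_right _ _)

omit [NeZero M] in
/-- **Weighted column sums of a doubled block**. [folklore] -/
theorem sum_norm_srcDoubleBlock_mul_col_le {N N' : ℕ} (T J : Matrix (SpaceTimeIdx L M × SectorLeg N') (SpaceTimeIdx L M × SectorLeg N) ℂ)
    (Tp : Matrix ((SpaceTimeIdx L M × SectorLeg N') × Fin 2) ((SpaceTimeIdx L M × SectorLeg N) × Fin 2) ℂ)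
    (hTp : ∀ p' p, Tp p' p = if p'.2 = 0 ∧ p.2 = 0 then T p'.1 p.1 else if p'.2 = 1 ∧ p.2 = 1 then J p'.1 p.1 else 0)
    (g : (SpaceTimeIdx L M × SectorLeg N') → (SpaceTimeIdx L M × SectorLeg N) → ℝ) {a b : ℝ}
    (hT : ∀ y, ∑ x, ‖T x y‖ * g x y ≤ a) (hJ : ∀ y, ∑ x, ‖J x y‖ * g x y ≤ b) (p : (SpaceTimeIdx L M × SectorLeg N) × Fin 2) :
    ∑ p', ‖Tp p' p‖ * g p'.1 p.1 ≤ max a b := by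
  have h10 : ¬ ((1 : Fin 2) = 0) := by decide
  have h01 : ¬ ((0 : Fin 2) = 1) := by decide
  have e00 : ∀ x y, Tp (x, 0) (y, 0) = T x y := fun x y => by rw [hTp, if_pos ⟨rfl, rfl⟩]
  have e11 : ∀ x y, Tp (x, 1) (y, 1) = J x y := fun x y => by rw [hTp, if_neg (fun h => h10 h.1), if_pos ⟨rfl, rfl⟩]
  have e01 : ∀ x y, Tp (x, 0) (y, 1) = 0 := fun x y => by rw [hTp, if_neg (fun h => h10 h.2), if_neg (fun h => h01 h.1)]
  have e10 : ∀ x y, Tp (x, 1) (y, 0) = 0 := fun x y => by rw [hTp, if_neg (fun h => h10 h.1), if_neg (fun h => h01 h.2)]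
  obtain ⟨y, s⟩ := p
  rw [Fintype.sum_prod_type]
  simp_rw [Fin.sum_univ_two]
  rcases Fin.exists_fin_two.1 ⟨s, rfl⟩ with hs | hs <;> subst hs
  · simp only [e00, e10, norm_zero, zero_mul, add_zero]
    exact (hT y).trans (le_max_left _ _)
  · simp only [e01, e11, norm_zero, zero_mul, zero_add]
    exact (hJ y).trans (le_max_right _ _)

/-! ## §2 The source-species block step of the model -/

/-- **THE SOURCE-SPECIES BLOCK STEP OF THE MODEL (door level).**  `k + 1 ≤ J₂`, `k + 1 ≤ J′`, `Z^K_{Λ_{k+1}} ≠ 0`; block covariance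
`S(F̃_k)ᵀ C^K_{(Λ_{J₂},Λ_{k+1}]} S(F̃_k)` replica-Gram-bounded (`κ`) with `klScaleWt r`-weighted rows/columns `≤ α`; overlap `E(F_{J′})·S(F̃_k)` with weighted rows
`≤ cr`, columns `≤ cc`; species budgets `S s m` of `klSrcPinnedSumAt … k r (k+1) s` (`s ≤ 2`); `0 < t`; radius `ρ` and the doors' guard at the blind profile
`N_t m′ := ε·(S 0 (2m′) + t·S 1 (2m′) + t²·S 2 (2m′))`; `N₀′ ≥ 2`.  Then for `s ≤ 2`, every `q`, pin `(p, w″)`: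
`ε · klSrcPinnedSumAt … J′ r J₂ s (2(q+1)) p w″ ≤ t^{-s} · max (ε cr) 1 · (max (ε cc) 1)^{2q+1} · [N_t(q+1) + binomial_{q+1}(N_t) + graded_{2q+2}(N_t)]`.
[cite: BenfattoGiulianiMastropietro2006, §2.7 (2.70)-(2.71a), §2.8 (2.80)-(2.83), §2.9 (4.3)-(4.8), (3.2)-(3.8)] -/
theorem klSrcPinnedSumAt_blockStep_le {β : ℝ} (hβ : 0 < β) (U μ : ℝ) (K : TrigPolyC4v) {k J₂ J' : ℕ}
    (hJ : k + 1 ≤ J₂) (hJ' : k + 1 ≤ J') (r : ℕ)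
    (hZ : hubbardEffPartitionFnCT L M β U μ 0 K (klScale klE0 (k + 1)) ≠ 0)
    {κ : ℝ} (hκ : 0 < κ)
    (hGB : IsGramBoundedR ((sectorSubMatrix L M β (bgmFatMultiplier L M klE0 β (nambuXiCT L μ K) k)).transpose *
      hubbardCovSliceCT L M β μ 0 K (klScale klE0 J₂) (klScale klE0 (k + 1)) *
        sectorSubMatrix L M β (bgmFatMultiplier L M klE0 β (nambuXiCT L μ K) k)) κ)
    {α : ℝ} (hα : 0 < α)
    (hrow : ∀ X, ∑ Y, ‖((sectorSubMatrix L M β (bgmFatMultiplier L M klE0 β (nambuXiCT L μ K) k)).transpose *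
        hubbardCovSliceCT L M β μ 0 K (klScale klE0 J₂) (klScale klE0 (k + 1)) *
          sectorSubMatrix L M β (bgmFatMultiplier L M klE0 β (nambuXiCT L μ K) k)) X Y‖ *
        klScaleWt L M β r {latticeLegPos (2 * (2 * M)) X, latticeLegPos (2 * (2 * M)) Y} ≤ α)
    (hcol : ∀ Y, ∑ X, ‖((sectorSubMatrix L M β (bgmFatMultiplier L M klE0 β (nambuXiCT L μ K) k)).transpose *
        hubbardCovSliceCT L M β μ 0 K (klScale klE0 J₂) (klScale klE0 (k + 1)) *
          sectorSubMatrix L M β (bgmFatMultiplier L M klE0 β (nambuXiCT L μ K) k)) X Y‖ *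
        klScaleWt L M β r {latticeLegPos (2 * (2 * M)) X, latticeLegPos (2 * (2 * M)) Y} ≤ α)
    (S : ℕ → ℕ → ℝ) (hS0 : ∀ s m, 0 ≤ S s m)
    (hS : ∀ s, s < 3 → ∀ (m : ℕ) (q : Fin m) (w : SrcLabel L M k), klSrcPinnedSumAt L M β U μ K k r (k + 1) s m q w ≤ S s m)
    {cr cc : ℝ}
    (hrow' : ∀ X'', ∑ X', ‖(sectorAnalysisMatrix L M β (klAnisoFamily L M β μ K klE0 J') *
        sectorSubMatrix L M β (bgmFatMultiplier L M klE0 β (nambuXiCT L μ K) k)) X'' X'‖ *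
        klScaleWt L M β r {latticeLegPos (2 * (2 * M)) X'', latticeLegPos (2 * (2 * M)) X'} ≤ cr)
    (hcol' : ∀ X', ∑ X'', ‖(sectorAnalysisMatrix L M β (klAnisoFamily L M β μ K klE0 J') *
        sectorSubMatrix L M β (bgmFatMultiplier L M klE0 β (nambuXiCT L μ K) k)) X'' X'‖ *
        klScaleWt L M β r {latticeLegPos (2 * (2 * M)) X'', latticeLegPos (2 * (2 * M)) X'} ≤ cc)
    {t : ℝ} (ht : 0 < t) {ρ : ℝ} (hρ : 0 < ρ)
    (hθ : Real.exp 1 * α * normV (SrcLabel L M k) κ ρ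
      (fun m' => imagTimeWeight β M * S 0 (2 * m') + t * (imagTimeWeight β M * S 1 (2 * m')) + t ^ 2 * (imagTimeWeight β M * S 2 (2 * m'))) / κ ^ 2 < 1)
    {N₀' : ℕ} (hN₀' : 2 ≤ N₀') {s : ℕ} (hs : s < 3) (q : ℕ) (p : Fin (2 * (q + 1))) (w'' : SrcLabel L M J') :
    imagTimeWeight β M * klSrcPinnedSumAt L M β U μ K J' r J₂ s (2 * (q + 1)) p w'' ≤
      t⁻¹ ^ s * (max (imagTimeWeight β M * cr) 1 * max (imagTimeWeight β M * cc) 1 ^ (2 * q + 1) *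
        ((imagTimeWeight β M * S 0 (2 * (q + 1)) + t * (imagTimeWeight β M * S 1 (2 * (q + 1))) + t ^ 2 * (imagTimeWeight β M * S 2 (2 * (q + 1)))) +
         (∑ m' ∈ range (Fintype.card (SrcLabel L M k) / 2 + 1),
            if q + 1 < m' then ((2 * m').choose (2 * (q + 1)) : ℝ) * κ ^ (2 * m' - 2 * (q + 1)) *
              (imagTimeWeight β M * S 0 (2 * m') + t * (imagTimeWeight β M * S 1 (2 * m')) + t ^ 2 * (imagTimeWeight β M * S 2 (2 * m'))) else 0) +
         (∑ n ∈ Ico 2 N₀', (ρ⁻¹ ^ (2 * (q + 1)) * κ⁻¹ ^ (2 * (n - 1)) * (α ^ (n - 1) * Real.exp n)) *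
              ∑ δ ∈ (Fintype.piFinset fun _ : Fin n => range (Fintype.card (SrcLabel L M k) / 2 + 1)) with
                  2 * (q + 1) + 2 * (n - 1) ≤ ∑ a, 2 * δ a,
                ∏ a, (Real.exp 2 * (κ + ρ)) ^ (2 * δ a) *
                  (imagTimeWeight β M * S 0 (2 * δ a) + t * (imagTimeWeight β M * S 1 (2 * δ a)) + t ^ 2 * (imagTimeWeight β M * S 2 (2 * δ a))) +
            ρ⁻¹ ^ (2 * (q + 1)) * (Real.exp 1 * normV (SrcLabel L M k) κ ρ
                (fun m' => imagTimeWeight β M * S 0 (2 * m') + t * (imagTimeWeight β M * S 1 (2 * m')) + t ^ 2 * (imagTimeWeight β M * S 2 (2 * m')))) *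
              (Real.exp 1 * α * normV (SrcLabel L M k) κ ρ
                  (fun m' => imagTimeWeight β M * S 0 (2 * m') + t * (imagTimeWeight β M * S 1 (2 * m')) + t ^ 2 * (imagTimeWeight β M * S 2 (2 * m'))) / κ ^ 2) ^ (N₀' - 1) /
              (1 - Real.exp 1 * α * normV (SrcLabel L M k) κ ρ
                  (fun m' => imagTimeWeight β M * S 0 (2 * m') + t * (imagTimeWeight β M * S 1 (2 * m')) + t ^ 2 * (imagTimeWeight β M * S 2 (2 * m'))) / κ ^ 2)))) := by
  haveI : NeZero (2 * (2 * M)) := ⟨by have := NeZero.ne M; omega⟩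
  have hβ0 : 0 ≤ β := hβ.le
  have hβne : β ≠ 0 := hβ.ne'
  have hε0 : 0 ≤ imagTimeWeight β M := imagTimeWeight_nonneg hβ0 M
  -- the matrices of the block
  set Cb : Matrix (SpaceTimeIdx L M × SectorLeg (sectorCount k)) (SpaceTimeIdx L M × SectorLeg (sectorCount k)) ℂ :=
    (sectorSubMatrix L M β (bgmFatMultiplier L M klE0 β (nambuXiCT L μ K) k)).transpose *
      hubbardCovSliceCT L M β μ 0 K (klScale klE0 J₂) (klScale klE0 (k + 1)) *
        sectorSubMatrix L M β (bgmFatMultiplier L M klE0 β (nambuXiCT L μ K) k) with hCb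
  set C' : Matrix (SrcLabel L M k) (SrcLabel L M k) ℂ := Matrix.of fun p q => if p.2 = 0 ∧ q.2 = 0 then Cb p.1 q.1 else 0 with hC'def
  have hC' : ∀ p q, C' p q = if p.2 = 0 ∧ q.2 = 0 then Cb p.1 q.1 else 0 := fun p q => rfl
  set T : Matrix (SpaceTimeIdx L M × SectorLeg (sectorCount J')) (SpaceTimeIdx L M × SectorLeg (sectorCount k)) ℂ :=
    ((((imagTimeWeight β M : ℝ) : ℂ)) • sectorAnalysisMatrix L M β (klAnisoFamily L M β μ K klE0 J')) *
      sectorSubMatrix L M β (bgmFatMultiplier L M klE0 β (nambuXiCT L μ K) k) with hTdef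
  set Jm : Matrix (SpaceTimeIdx L M × SectorLeg (sectorCount J')) (SpaceTimeIdx L M × SectorLeg (sectorCount k)) ℂ :=
    Matrix.of fun Y' Y => if Y'.1 = Y.1 ∧ (Y'.2.1.1 : ℕ) = 0 ∧ (Y.2.1.1 : ℕ) = 0 ∧ Y'.2.1.2 = Y.2.1.2 ∧ Y'.2.2 = Y.2.2 then (1 : ℂ) else 0
    with hJmdef
  have hJm : ∀ Y' Y, Jm Y' Y = if Y'.1 = Y.1 ∧ (Y'.2.1.1 : ℕ) = 0 ∧ (Y.2.1.1 : ℕ) = 0 ∧ Y'.2.1.2 = Y.2.1.2 ∧ Y'.2.2 = Y.2.2 then 1 else 0 :=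
    fun Y' Y => rfl
  set Tp : Matrix (SrcLabel L M J') (SrcLabel L M k) ℂ :=
    Matrix.of fun p' p => if p'.2 = 0 ∧ p.2 = 0 then T p'.1 p.1 else if p'.2 = 1 ∧ p.2 = 1 then Jm p'.1 p.1 else 0 with hTpdef
  have hTp : ∀ p' p, Tp p' p = if p'.2 = 0 ∧ p.2 = 0 then T p'.1 p.1 else if p'.2 = 1 ∧ p.2 = 1 then Jm p'.1 p.1 else 0 := fun p' p => rfl
  -- S1: the block identity (`k + 1 - 1 = k`)
  have hid : ExteriorAlgebra.map (Matrix.toLin' ((((imagTimeWeight β M : ℝ) : ℂ)) • klSrcAnalysisAt L M β μ K J'))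
        (klEffectiveAction L M β U μ K klE0 J₂) =
      ExteriorAlgebra.map (Matrix.toLin' Tp) (effAction ℂ C' (klTowerD L M β U μ K k)) :=
    klSrcBlock_eq_map_doubleBlock_effAction (J₁ := k + 1) hβne U μ K (by omega) hJ hJ' hZ C' hC' Jm hJm Tp hTp
  -- the input: even, no constant part, species profiles `ε·S`
  have hDe : klTowerD L M β U μ K k ∈ evenPart ℂ (SrcLabel L M k) :=
    mem_evenPart_iff.2 (map_mem_evenOdd_zero ℂ _ (mem_evenPart_iff.1 (klEffectiveAction_mem_evenPart hβne U μ K klE0 (k + 1))))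
  have hD0 : constPart ℂ (klTowerD L M β U μ K k) = 0 := by
    rw [klTowerD, constPart_map, EngineV8.constPart_klEffectiveAction_eq_zero β U μ K klE0 (k + 1) hZ]
  have hN : ∀ (s' : ℕ), s' < 3 → ∀ (m' : ℕ) (j : Fin (2 * m')) (w : SrcLabel L M k),
      ∑ Y ∈ univ.filter (fun Y : Fin (2 * m') → SrcLabel L M k => Y j = w ∧ srcCount (fun Y : SrcLabel L M k => Y.2 = 1) Y = s'),
        ‖kernel ℂ (klTowerD L M β U μ K k) (2 * m') Y‖ *
          klScaleWt L M β r ((univ.image Y).image (fun Y : SrcLabel L M k => latticeLegPos (2 * (2 * M)) Y.1)) ≤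
        (if s' = 0 then imagTimeWeight β M * S 0 (2 * m') else if s' = 1 then imagTimeWeight β M * S 1 (2 * m') else imagTimeWeight β M * S 2 (2 * m')) := by
    intro s' hs' m' j w
    rcases Nat.eq_zero_or_pos m' with hm0 | hm0
    · subst hm0; exact absurd j.2 (by omega)
    have h := sum_srcCount_filter_eq_eps_mul_klSrcPinnedSumAt hβ0 U μ K k r s' (2 * m') (by omega) j w
    have hle : imagTimeWeight β M * klSrcPinnedSumAt L M β U μ K k r (k + 1) s' (2 * m') j w ≤ imagTimeWeight β M * S s' (2 * m') :=
      mul_le_mul_of_nonneg_left (hS s' hs' (2 * m') j w) hε0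
    have heq : ∑ Y ∈ univ.filter (fun Y : Fin (2 * m') → SrcLabel L M k => Y j = w ∧ srcCount (fun Y : SrcLabel L M k => Y.2 = 1) Y = s'),
        ‖kernel ℂ (klTowerD L M β U μ K k) (2 * m') Y‖ *
          klScaleWt L M β r ((univ.image Y).image (fun Y : SrcLabel L M k => latticeLegPos (2 * (2 * M)) Y.1)) =
        imagTimeWeight β M * klSrcPinnedSumAt L M β U μ K k r (k + 1) s' (2 * m') j w := by
      rw [← h]; exact sum_congr rfl fun Y _ => mul_comm _ _
    rw [heq]
    rcases s' with _ | _ | _ | s'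
    · rw [if_pos rfl]; exact hle
    · rw [if_neg (by decide), if_pos rfl]; exact hle
    · rw [if_neg (by decide), if_neg (by decide)]; exact hle
    · omega
  -- the weighted costs of `T⁺`
  have hnε : ‖(((imagTimeWeight β M : ℝ) : ℂ))‖ = imagTimeWeight β M := by
    rw [Complex.norm_real, Real.norm_of_nonneg hε0]
  have hTrow : ∀ x, ∑ y, ‖T x y‖ * klScaleWt L M β r {latticeLegPos (2 * (2 * M)) x, latticeLegPos (2 * (2 * M)) y} ≤
      imagTimeWeight β M * cr := by
    intro x
    have h := hrow' x
    have heq : ∀ y, ‖T x y‖ * klScaleWt L M β r {latticeLegPos (2 * (2 * M)) x, latticeLegPos (2 * (2 * M)) y} =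
        imagTimeWeight β M * (‖(sectorAnalysisMatrix L M β (klAnisoFamily L M β μ K klE0 J') *
          sectorSubMatrix L M β (bgmFatMultiplier L M klE0 β (nambuXiCT L μ K) k)) x y‖ *
          klScaleWt L M β r {latticeLegPos (2 * (2 * M)) x, latticeLegPos (2 * (2 * M)) y}) := by
      intro y
      rw [hTdef, Matrix.smul_mul, Matrix.smul_apply, smul_eq_mul, norm_mul, hnε, mul_assoc]
    rw [Finset.sum_congr rfl fun y _ => heq y, ← mul_sum]
    exact mul_le_mul_of_nonneg_left h hε0
  have hTcol : ∀ y, ∑ x, ‖T x y‖ * klScaleWt L M β r {latticeLegPos (2 * (2 * M)) x, latticeLegPos (2 * (2 * M)) y} ≤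
      imagTimeWeight β M * cc := by
    intro y
    have h := hcol' y
    have heq : ∀ x, ‖T x y‖ * klScaleWt L M β r {latticeLegPos (2 * (2 * M)) x, latticeLegPos (2 * (2 * M)) y} =
        imagTimeWeight β M * (‖(sectorAnalysisMatrix L M β (klAnisoFamily L M β μ K klE0 J') *
          sectorSubMatrix L M β (bgmFatMultiplier L M klE0 β (nambuXiCT L μ K) k)) x y‖ *
          klScaleWt L M β r {latticeLegPos (2 * (2 * M)) x, latticeLegPos (2 * (2 * M)) y}) := by
      intro x
      rw [hTdef, Matrix.smul_mul, Matrix.smul_apply, smul_eq_mul, norm_mul, hnε, mul_assoc]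
    rw [Finset.sum_congr rfl fun x _ => heq x, ← mul_sum]
    exact mul_le_mul_of_nonneg_left h hε0
  have hJrow := sum_norm_slotShift_mul_row_le_one (L := L) (M := M) hβ0 r (sectorCount_pos k) Jm hJm
  have hJcol := sum_norm_slotShift_mul_col_le_one (L := L) (M := M) hβ0 r (sectorCount_pos J') Jm hJm
  have hrowTp : ∀ X'', ∑ X, ‖Tp X'' X‖ * klScaleWt L M β r {latticeLegPos (2 * (2 * M)) X''.1, latticeLegPos (2 * (2 * M)) X.1} ≤
      max (imagTimeWeight β M * cr) 1 :=
    sum_norm_srcDoubleBlock_mul_row_le T Jm Tp hTp (fun x y => klScaleWt L M β r {latticeLegPos (2 * (2 * M)) x, latticeLegPos (2 * (2 * M)) y})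
      hTrow hJrow
  have hcolTp : ∀ X, ∑ X'', ‖Tp X'' X‖ * klScaleWt L M β r {latticeLegPos (2 * (2 * M)) X''.1, latticeLegPos (2 * (2 * M)) X.1} ≤
      max (imagTimeWeight β M * cc) 1 :=
    sum_norm_srcDoubleBlock_mul_col_le T Jm Tp hTp (fun x y => klScaleWt L M β r {latticeLegPos (2 * (2 * M)) x, latticeLegPos (2 * (2 * M)) y})
      hTcol hJcol
  have hTsrc : ∀ (X : SrcLabel L M k) (X'' : SrcLabel L M J'), Tp X'' X ≠ 0 → (X.2 = 1 ↔ X''.2 = 1) := by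
    intro X X'' hne
    rw [hTp] at hne
    by_cases h0 : X''.2 = 0 ∧ X.2 = 0
    · rw [h0.1, h0.2]
    · rw [if_neg h0] at hne
      by_cases h1 : X''.2 = 1 ∧ X.2 = 1
      · rw [h1.1, h1.2]
      · rw [if_neg h1] at hne; exact absurd rfl hne
  have hmax0 : 0 ≤ max (imagTimeWeight β M * cc) 1 := zero_le_one.trans (le_max_right _ _)
  -- S2 on the doubled labels
  have hstep := sum_species_wt_norm_kernel_blockStep_le (𝕜 := ℂ) (isTreeWeight_klScaleWt L M hβ0 r)
    (latticeLegPos (2 * (2 * M))) (latticeLegPos (2 * (2 * M))) Cb C' hC' hκ hGB hα hrow hcol (klTowerD L M β U μ K k) hDe hD0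
    (fun m' => imagTimeWeight β M * S 0 (2 * m')) (fun m' => imagTimeWeight β M * S 1 (2 * m')) (fun m' => imagTimeWeight β M * S 2 (2 * m'))
    (fun m' => mul_nonneg hε0 (hS0 _ _)) (fun m' => mul_nonneg hε0 (hS0 _ _)) (fun m' => mul_nonneg hε0 (hS0 _ _)) hN Tp hTsrc hmax0 hrowTp hcolTp
    ht hρ hθ hN₀' hs q p w''
  -- the output: the species profile of `map (ε•klSrcAnalysisAt J′) 𝒱_{J₂}` is `ε · klSrcPinnedSumAt … J′ r J₂ s`
  have hout : ∑ X'' ∈ univ.filter (fun X'' : Fin (2 * (q + 1)) → SrcLabel L M J' => X'' p = w'' ∧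
        srcCount (fun Y : SrcLabel L M J' => Y.2 = 1) X'' = s),
      klScaleWt L M β r ((univ.image X'').image (fun Y : SrcLabel L M J' => latticeLegPos (2 * (2 * M)) Y.1)) *
        ‖kernel ℂ (ExteriorAlgebra.map (Matrix.toLin' Tp) (effAction ℂ C' (klTowerD L M β U μ K k))) (2 * (q + 1)) X''‖ =
      imagTimeWeight β M * klSrcPinnedSumAt L M β U μ K J' r J₂ s (2 * (q + 1)) p w'' := by
    rw [← hid, klSrcPinnedSumAt_def, mul_sum, mul_sum]
    refine sum_congr rfl fun X'' _ => ?_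
    rw [kernel_map_smul_klSrcAnalysisAt, norm_mul, norm_pow, hnε,
      show imagTimeWeight β M ^ (2 * (q + 1)) = imagTimeWeight β M * imagTimeWeight β M ^ (2 * (q + 1) - 1) by
        rw [← pow_succ', Nat.sub_add_cancel (by omega)]]
    show _ = imagTimeWeight β M * (imagTimeWeight β M ^ (2 * (q + 1) - 1) *
      (klScaleWt L M β r ((univ.image X'').image (srcLegPos L M (2 * (2 * M)))) *
        ‖kernel ℂ (klSrcActionAt L M β U μ K J' J₂) (2 * (q + 1)) X''‖))
    have hπ : (fun Y : SrcLabel L M J' => latticeLegPos (2 * (2 * M)) Y.1) = srcLegPos L M (2 * (2 * M)) := rfl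
    rw [hπ]
    ring
  rw [← hout]
  exact hstep

end Summit.HubbardSuperconductivity.HubbardSuperconductivity.Theorems.TwoVolumeDefect

end
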